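import Summits.Schanuel.Schanuel.Theorems.RootDecomp1KDescent01

/-!
# RootDecomp1KDescent — lens 1, generation 58, NODE 19 «DESCENT ON THE K-LINE» (Chevalley–Weil 2-descent to an étale double cover, then 2-adic Runge on the cover; RULE K-R49 (iii) payable clause; CLAIM L2723, PRICE L2727, K-R50) — continuation (RootDecomp1KDescent02): §5 the 2-adic Runge step on the double cover, §6 the descent certificate and the integer I

(lens-1 g58 NODE 19 HOME kernel K = HOME/decomp-schanuel-lens-1/g58/Descent.lean 92ee3617…, 1568 l, 121 thm + 32 defs/structures (structure DescentCert, structure EisQ), imports tree …RootDecomp1KRunge06 ONLY = the port of node 18 (no Literature import, no fact def, no private, no set_option, no axiom / instance / sorry / native_decide); Probe / Ctrl0 / Ctrl (56 planted controls, ctrl_table19.txt) + NODE-g58.md + cert58.json/.txt + SHA256SUMS (34 files); CLAIM L2723, writer CHECK NOTE L2724/L2725 (certificate arithmetic reproduced at 13 values of λ), crit g10 EX-ANTE PRICE L2727 (ONE THEOREM ×1 for (A) engine + (B) the class DJ(3^j) + (C) territory JOINTLY iff CHECKLIST K-g58 (1)–(10); RULE K-R50 pre-announced; node-18 label erratum),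 census LIVENESS-v10 L2733 (keys k2 / desc2; DJ rows; of record L2735), NODE L2743, critic VERDICT L2746 (crit g10): CLEARED — THEOREM ×1 for (A) engine + (B) the class {DJ 3^j} + (C) territory JOINTLY under RULE K-R49 (iii) («an infinite class of K-R49-territory pairs made unconditional», currency LevelFinite — strictly stronger than the residual ThinFibreAt 2), checklist K-g58 (1)–(10) met, rung 0; labels of record: VARIANT of a KNOWN TOOL (Levin 2008 §3 Thm 6 «Coverings and Runge's method» [corpus:paper:arxiv-0805.1345 p.7]) · PROBLEM-RELATIVE NEW (first descent on the K-line; first members outside every Runge-certifiable class; first LevelFinite for a positive-genus non-uniformised member); RULE K-R50 FIXED (toolkit of record ∪= 2-DESCENT via ℚ-rational 2-torsion of the Jacobian — for k = 2 a factorisation of Δ_x = c₁² − 4c₀c₂ over ℚ, in particular the square type −4·A·B with A + B = c₂ — twists killed by congruences / supports, then any toolkit step upstairs, every further such member / family / presentation / cover degree 2^r / Eisenstein prime / the abstract Descent2At engine ×0-as-record; OPEN TERRITORY at m₀ = 2 := K-R49 territory ∧ Jac has NO ℚ-rational 2-torsion datum — for k = 2 certified by «Δ_x ℚ-irreducible of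 degree ≡ 2 (mod 4)»; standing witness W4 (census TM33); UNCONDITIONAL PART ∪= {DJ 3^j} at the currency LevelFinite); PORT GO exactly as census STAGING NOTE 9 L2744 (agreed by the lens L2745) with the edits (a) + (b) SANCTIONED. Port by census-1 gen 23 as `RootDecomp1KDescent01–06` (`--supports stmt-Schanuel-33364`; no census credit): 01 = §0 small facts, §1 the curves `dsP Q A = x²·Q(Y) + (2x+1)·A(Y)` (`dsC`, `bev_dsP`), §2 the level equation in integers, §3 the Eisenstein form of `F_Q` (`structure EisQ`) and the homogenised `Y⁶`-identity, §4 THE DESCENT LEMMA (`twist_mod_eight`, `twist_support`, `twist_kill`, `twist_le`, **`descent`**); 02 = §5 the 2-adic Runge step on the double cover (`exists_sign_small`, ultrametric bookkeeping in ℂ₂), §6 `structure DescentCert Q A` (integral data + identities only) and the integer `dsI`; 03 = §7 the lift of a level point to the cover read in ℂ₂ (‖I‖₂ ≤ (2/‖D‖₂)·2^{−3·N!} for one sign), §8 the norm `dsNu`, the archimedean size of `I`, the endgame (`endgame_ds`, cost 5 < 6 = 2μ); 04 = §9 THE ENGINE **`levelFinite_of_descentCert : DescentCert Q A → LevelFinite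 (dsP Q A)`** and `thinFibreAt_of_descentCert` (every m₀); 05 = §10 THE FAMILY `DJ λ` (`djQ = Y⁴+3Y³+3Y²+3`, `djA`, `DJ`), ONE certificate `djCert j` polynomial in λ = 3^j, **`levelFinite_DJ : ∀ j, LevelFinite (DJ (3^j))`**, **`thinFibreAt_DJ : ∀ j m₀, ThinFibreAt m₀ (DJ (3^j))`** HYPOTHESIS-FREE, `DJ_injective`, named members `DJ1` `DJ3` `DJ9`; 06 = §11 TERRITORY (section Territory) by tree names: `isEisensteinAt_djQ`, irreducibility of the top over ℚ, **`DJ_territory`**, the named members' territory. PORT EDITS: (a) 16 one-line docstrings quoting the signature on the undocumented decls (`dsC_two` / `dsC_one` / `dsC_zero` / `dsC_of_gt`, `natDegree_djA_le`, `natDegree_djT_le`, `natDegree_djF0_le` … `natDegree_djF3_le`, `levelFinite_DJ1/3/9`, `thinFibreAt_two_DJ1/3/9`); (b) PRIVATISATION ×5 of one-liners that the head dry-run flagged as near-duplicates of foreign / out-of-cone declarations — `odd_three_pow` (≡ a Crystal3D decl), `norm_intCast_le_one_ds` (≡ a BirchSwinnertonDyer decl; tree-private twins in Runge01 / LocalExponent01),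 `eight_dvd_sq_sub_one_ds` (≡ a HodgeConjecture decl), `isCoprime_num_den_ds` (≡ `Literature.NumberTheory.DiophantineApproximation.isCoprime_num_den`, not in the import cone), `odd_psNumer_ds` (≡ `RootDecomp1KCollarCell.odd_psNumer_two`, same summit but outside the cone — importing CollarCell02 would add 53 modules) — with file-local private copies re-emitted where a later part uses them (03: `norm_intCast_le_one_ds`, `odd_three_pow`; 04: `isCoprime_num_den_ds`, `odd_psNumer_ds`; 05: `odd_three_pow`); nothing else (no deletion, no replacement, no import added, no set_option; K's three `@[simp]` kept); provenance doc blocks + continuation headers = K's own open-lines; statements and proofs VERBATIM. Rung 0 — nothing here proves Schanuel, 33364, 33363, 31077 or ThinFibre 2; everything HYPOTHESIS-FREE.)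
-/

noncomputable section

namespace Summit.Schanuel.Schanuel.Theorems.RootDecomp1KDescent

open Polynomial LiouvilleNumber
open scoped Nat
open Summit.Schanuel.Schanuel.Theorems.RootDecomp1KTwoBaseCell (psNumer partialSum_eq_psNumer_div coprime_psNumer)
open Summit.Schanuel.Schanuel.Theorems.RootDecomp1KRelLiouvilleCell (partialSum_two_strictMono)
open Summit.Schanuel.Schanuel.Theorems.RootDecomp1KDegreeLadder
open Summit.Schanuel.Schanuel.Theorems.RootDecomp1KXLinear
open Summit.Schanuel.Schanuel.Theorems.RootDecomp1KXLinearII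
open Summit.Schanuel.Schanuel.Theorems.RootDecomp1KXTop
open Summit.Schanuel.Schanuel.Theorems.RootDecomp1KXAll
open Summit.Schanuel.Schanuel.Theorems.RootDecomp1KLevelFinite
open Summit.Schanuel.Schanuel.Theorems.RootDecomp1KThueMahler
open Summit.Schanuel.Schanuel.Theorems.RootDecomp1KParamThueMahler
open Summit.Schanuel.Schanuel.Theorems.RootDecomp1KLocalExponent
open Summit.Schanuel.Schanuel.Theorems.RootDecomp1KRunge

/-! ### §5 THE 2-ADIC RUNGE STEP ON THE DOUBLE COVER (ultrametric bookkeeping in `ℂ₂`) -/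

/-- ultrametric: `‖a + b‖ ≤ t` from `‖a‖ ≤ t`, `‖b‖ ≤ t`. -/
theorem norm_add_le_of_le_ds {a b : PadicAlgCl 2} {t : ℝ} (ha : ‖a‖ ≤ t) (hb : ‖b‖ ≤ t) : ‖a + b‖ ≤ t :=
  (IsUltrametricDist.norm_add_le_max a b).trans (max_le ha hb)

/-- ultrametric: `‖a − b‖ ≤ t` from `‖a‖ ≤ t`, `‖b‖ ≤ t`. -/
theorem norm_sub_le_of_le_ds {a b : PadicAlgCl 2} {t : ℝ} (ha : ‖a‖ ≤ t) (hb : ‖b‖ ≤ t) : ‖a - b‖ ≤ t := by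
  rw [sub_eq_add_neg]; exact norm_add_le_of_le_ds ha (by rwa [norm_neg])

/-- ultrametric: `‖a + b‖ = ‖a‖` when `‖b‖ < ‖a‖`. -/
theorem norm_add_eq_of_lt_ds {a b : PadicAlgCl 2} (h : ‖b‖ < ‖a‖) : ‖a + b‖ = ‖a‖ := by
  rw [IsUltrametricDist.norm_add_eq_max_of_norm_ne_norm (ne_of_gt h), max_eq_left h.le]

/-- ultrametric: `‖a − b‖ = ‖a‖` when `‖b‖ < ‖a‖`. -/
theorem norm_sub_eq_of_lt_ds {a b : PadicAlgCl 2} (h : ‖b‖ < ‖a‖) : ‖a - b‖ = ‖a‖ := by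
  rw [sub_eq_add_neg]; exact norm_add_eq_of_lt_ds (by rwa [norm_neg])

/-- ultrametric: if `‖a + b‖ = m` then `m ≤ ‖a‖` or `m ≤ ‖b‖`. -/
theorem le_norm_or_le_norm_ds {a b : PadicAlgCl 2} {m : ℝ} (h : ‖a + b‖ = m) : m ≤ ‖a‖ ∨ m ≤ ‖b‖ := by
  rcases le_max_iff.mp (h ▸ IsUltrametricDist.norm_add_le_max a b) with h' | h'
  · exact Or.inl h'
  · exact Or.inr h'

/-- a product bound: `‖a‖ · m ≤ T` with `0 < m` and `‖b‖ = m`... from `‖a · b‖ ≤ T`: `‖a‖ ≤ T / m`. -/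
theorem norm_le_div_of_mul_ds {a b : PadicAlgCl 2} {m T : ℝ} (hm : 0 < m) (hb : m ≤ ‖b‖) (hab : ‖a * b‖ ≤ T) :
    ‖a‖ ≤ T / m := by
  rw [le_div_iff₀ hm]
  calc ‖a‖ * m ≤ ‖a‖ * ‖b‖ := mul_le_mul_of_nonneg_left hb (norm_nonneg _)
    _ = ‖a * b‖ := (norm_mul a b).symm
    _ ≤ T := hab

/-- `‖x³·u‖ ≤ ε³` for `‖x‖ ≤ ε`, `‖u‖ ≤ 1`. -/
theorem norm_cube_mul_le_ds {x u : PadicAlgCl 2} {ε : ℝ} (hx : ‖x‖ ≤ ε) (hu : ‖u‖ ≤ 1) : ‖x ^ 3 * u‖ ≤ ε ^ 3 := by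
  rw [norm_mul, norm_pow]
  calc ‖x‖ ^ 3 * ‖u‖ ≤ ε ^ 3 * 1 :=
        mul_le_mul (pow_le_pow_left₀ (norm_nonneg _) hx 3) hu (norm_nonneg _)
          (pow_nonneg ((norm_nonneg _).trans hx) 3)
    _ = ε ^ 3 := mul_one _

/-- **THE SIGN CHOICE.**  From `Rz² + D²·A(y) = Q(y)³·U₁` with `A(y) = −ζ₁²`, `‖Rz‖ = ‖D‖`, `‖Q(y)‖ ≤ ε`:
one of the two lifts `±ζ₁` has `‖Rz − D·(±ζ₁)‖ ≤ 2ε³/‖D‖`. -/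
theorem sign_choice_ds {Qy Ay ζ₁ D Rz U₁ : PadicAlgCl 2} {ε : ℝ} (hD0 : 0 < ‖D‖) (hQ : ‖Qy‖ ≤ ε) (hU1 : ‖U₁‖ ≤ 1)
    (hA : Ay = -ζ₁ ^ 2) (hRid : Rz ^ 2 + D ^ 2 * Ay = Qy ^ 3 * U₁) (hRn : ‖Rz‖ = ‖D‖) :
    ∃ s : PadicAlgCl 2, (s = 1 ∨ s = -1) ∧ ‖Rz - D * (s * ζ₁)‖ ≤ 2 * ε ^ 3 / ‖D‖ := by
  have h2 : ‖(Rz - D * ζ₁) + (Rz + D * ζ₁)‖ = ‖D‖ / 2 := by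
    rw [show (Rz - D * ζ₁) + (Rz + D * ζ₁) = 2 * Rz by ring, norm_mul, norm_two_Cp, hRn]; ring
  have hprod : ‖(Rz - D * ζ₁) * (Rz + D * ζ₁)‖ ≤ ε ^ 3 := by
    rw [show (Rz - D * ζ₁) * (Rz + D * ζ₁) = Qy ^ 3 * U₁ by linear_combination hRid - D ^ 2 * hA]
    exact norm_cube_mul_le_ds hQ hU1
  have hm : 0 < ‖D‖ / 2 := by positivity
  have e : 2 * ε ^ 3 / ‖D‖ = ε ^ 3 / (‖D‖ / 2) := by field_simp
  rcases le_norm_or_le_norm_ds h2 with h | h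
  · refine ⟨-1, Or.inr rfl, ?_⟩
    rw [show Rz - D * ((-1) * ζ₁) = Rz + D * ζ₁ by ring, e]
    exact norm_le_div_of_mul_ds hm h (by rwa [mul_comm] at hprod)
  · refine ⟨1, Or.inl rfl, ?_⟩
    rw [one_mul, e]
    exact norm_le_div_of_mul_ds hm h hprod

/-- **THE 2-ADIC RUNGE STEP ON THE COVER.**  At a point `(y, ζ₁, ζ₂)` of `C' : ζ₁² = −A(y), ζ₂² = B(y)` in `ℂ₂` with
`‖y‖ = 1`, `‖Q(y)‖ ≤ ε`, `‖ζ₂ − ζ₁‖ ≤ ε` (the branch `O₊`) and `‖Rz(y) − D·ζ₁‖ ≤ 2ε³/‖D‖` (the sign choice), an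
integral descent certificate makes `D²·Φ(y, ζ₁, ζ₂)` of size `≤ 2ε³/‖D‖` — vanishing order THREE along `O₊`
(`2ε < ‖D‖`). -/
theorem runge_cover_ds {y Qy By ζ₁ ζ₂ D μ Rz Sz V W U₂ F0 F1 F2 F3 Ω₁ : PadicAlgCl 2} {ε : ℝ}
    (hy : ‖y‖ = 1) (hμ : ‖μ‖ = 1) (hD0 : 0 < ‖D‖) (hD1 : ‖D‖ ≤ 1) (hQ : ‖Qy‖ ≤ ε) (hε1 : 2 * ε < ‖D‖)
    (hV : ‖V‖ ≤ 1) (hW : ‖W‖ ≤ 1) (hU2 : ‖U₂‖ ≤ 1) (hF1 : ‖F1‖ ≤ 1) (hF2 : ‖F2‖ ≤ 1)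
    (hF3 : ‖F3‖ ≤ 1) (hΩ1 : ‖Ω₁‖ ≤ 1) (hζ2 : ‖ζ₂‖ ≤ 1) (hB : By = ζ₂ ^ 2) (hζ : ‖ζ₂ - ζ₁‖ ≤ ε)
    (hSid : Sz ^ 2 - D ^ 2 * By = Qy ^ 3 * U₂) (hRV : Rz = D * μ * y ^ 3 + Qy * V) (hSW : Sz = Rz + Qy * W)
    (hΩ : D ^ 2 * F0 + D * F1 * Rz + D * F2 * Sz + F3 * Rz * Sz = Qy ^ 3 * Ω₁)
    (hR1 : ‖Rz - D * ζ₁‖ ≤ 2 * ε ^ 3 / ‖D‖) :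
    ‖D ^ 2 * F0 + D * F1 * (D * ζ₁) + D * F2 * (D * ζ₂) + F3 * (D * ζ₁) * (D * ζ₂)‖ ≤ 2 * ε ^ 3 / ‖D‖ := by
  set δ : ℝ := 2 * ε ^ 3 / ‖D‖ with hδ
  have hε0 : 0 ≤ ε := (norm_nonneg _).trans hQ
  have hεD : ε < ‖D‖ := by linarith
  have hε3 : ε ^ 3 ≤ δ := by
    rw [hδ, le_div_iff₀ hD0]; nlinarith [pow_nonneg hε0 3]
  have hδε : δ ≤ ε := by
    rw [hδ, div_le_iff₀ hD0]
    have h2ε : 2 * ε ≤ 1 := by linarith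
    calc 2 * ε ^ 3 = (2 * ε) * (ε * ε) := by ring
      _ ≤ 1 * (ε * ε) := mul_le_mul_of_nonneg_right h2ε (mul_nonneg hε0 hε0)
      _ = ε * ε := one_mul _
      _ ≤ ε * ‖D‖ := mul_le_mul_of_nonneg_left hεD.le hε0
  have hone : ∀ {a b : PadicAlgCl 2}, ‖a‖ ≤ 1 → ‖b‖ ≤ 1 → ‖a * b‖ ≤ 1 := fun ha hb => by
    rw [norm_mul]; exact mul_le_one₀ ha (norm_nonneg _) hb
  -- `‖Rz‖ = ‖Sz‖ = ‖D‖`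
  have hRn : ‖Rz‖ = ‖D‖ := by
    have h1 : ‖D * μ * y ^ 3‖ = ‖D‖ := by rw [norm_mul, norm_mul, norm_pow, hμ, hy]; ring
    have h2 : ‖Qy * V‖ < ‖D * μ * y ^ 3‖ := by
      rw [h1, norm_mul]; exact lt_of_le_of_lt (mul_le_of_le_one_right (norm_nonneg _) hV) (hQ.trans_lt hεD)
    rw [hRV, norm_add_eq_of_lt_ds h2, h1]
  have hSn : ‖Sz‖ = ‖D‖ := by
    have h2 : ‖Qy * W‖ < ‖Rz‖ := by
      rw [hRn, norm_mul]; exact lt_of_le_of_lt (mul_le_of_le_one_right (norm_nonneg _) hW) (hQ.trans_lt hεD)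
    rw [hSW, norm_add_eq_of_lt_ds h2, hRn]
  -- `‖Sz − Dζ₂‖ ≤ ε`, then `≤ δ`
  have hS1 : ‖Sz - D * ζ₂‖ ≤ ε := by
    have e : Sz - D * ζ₂ = (Qy * W + (Rz - D * ζ₁)) - D * (ζ₂ - ζ₁) := by rw [hSW]; ring
    rw [e]
    refine norm_sub_le_of_le_ds (norm_add_le_of_le_ds ?_ (hR1.trans hδε)) ?_
    · rw [norm_mul]; exact (mul_le_of_le_one_right (norm_nonneg _) hW).trans hQ
    · rw [norm_mul]; exact (mul_le_mul hD1 hζ (norm_nonneg _) zero_le_one).trans (by rw [one_mul])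
  have hS2 : ‖D‖ / 2 ≤ ‖Sz + D * ζ₂‖ := by
    have e : Sz + D * ζ₂ = 2 * Sz - (Sz - D * ζ₂) := by ring
    have h2S : ‖(2 : PadicAlgCl 2) * Sz‖ = ‖D‖ / 2 := by rw [norm_mul, norm_two_Cp, hSn]; ring
    rw [e, norm_sub_eq_of_lt_ds (by rw [h2S]; linarith), h2S]
  have hSδ : ‖Sz - D * ζ₂‖ ≤ δ := by
    have hprod : ‖(Sz - D * ζ₂) * (Sz + D * ζ₂)‖ ≤ ε ^ 3 := by
      rw [show (Sz - D * ζ₂) * (Sz + D * ζ₂) = Qy ^ 3 * U₂ by linear_combination hSid + D ^ 2 * hB]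
      exact norm_cube_mul_le_ds hQ hU2
    have := norm_le_div_of_mul_ds (by positivity : 0 < ‖D‖ / 2) hS2 hprod
    rw [hδ]; convert this using 1; field_simp
  -- the value of `D²Φ`
  have e : D ^ 2 * F0 + D * F1 * (D * ζ₁) + D * F2 * (D * ζ₂) + F3 * (D * ζ₁) * (D * ζ₂) =
      (D ^ 2 * F0 + D * F1 * Rz + D * F2 * Sz + F3 * Rz * Sz) +
      ((D * F1 * (D * ζ₁ - Rz) + D * F2 * (D * ζ₂ - Sz)) +
        (F3 * (D * ζ₂) * (D * ζ₁ - Rz) + F3 * Rz * (D * ζ₂ - Sz))) := by ring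
  rw [e, hΩ]
  have hR1' : ‖D * ζ₁ - Rz‖ ≤ δ := by rw [norm_sub_rev]; exact hR1
  have hS1' : ‖D * ζ₂ - Sz‖ ≤ δ := by rw [norm_sub_rev]; exact hSδ
  have hDζ2 : ‖D * ζ₂‖ ≤ 1 := hone hD1 hζ2
  have key : ∀ {c x : PadicAlgCl 2}, ‖c‖ ≤ 1 → ‖x‖ ≤ δ → ‖c * x‖ ≤ δ := fun hc hx => by
    rw [norm_mul]
    calc _ ≤ 1 * δ := mul_le_mul hc hx (norm_nonneg _) zero_le_one
      _ = δ := one_mul δ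
  refine norm_add_le_of_le_ds ((norm_cube_mul_le_ds hQ hΩ1).trans hε3) (norm_add_le_of_le_ds ?_ ?_)
  · exact norm_add_le_of_le_ds (key (hone hD1 hF1) hR1') (key (hone hD1 hF2) hS1')
  · exact norm_add_le_of_le_ds (key (hone hF3 hDζ2) hR1') (key (hone hF3 (hRn.le.trans hD1)) hS1')

/-! ### §6 THE INTEGRAL DESCENT CERTIFICATE and the integer `I` -/

/-- the NORM `ν = g₀² − B·g₁²` of the Runge function `Φ = F₀ + F₁z₁ + F₂z₂ + F₃z₁z₂` down to `ℚ(Y)`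
(`B = Q − A`, `g₀ = F₀² + B·F₂² + A·F₁² + A·B·F₃²`, `g₁ = 2(F₀F₂ + A·F₁F₃)`): `Φ = 0 ⟹ ν(Y) = 0` on `C'`. -/
def dsNu (Q A F0 F1 F2 F3 : ℤ[X]) : ℤ[X] :=
  (F0 ^ 2 + (Q - A) * F2 ^ 2 + A * F1 ^ 2 + A * (Q - A) * F3 ^ 2) ^ 2 -
    (Q - A) * (2 * (F0 * F2 + A * F1 * F3)) ^ 2

/-- **AN INTEGRAL DESCENT CERTIFICATE** for the pair `(Q, A)` (`P = x²Q + (2x+1)A`, cover `z₁² = −A`, `z₂² = Q − A`):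
the Eisenstein top `Q`, `A = λ²(Q·T − Y⁶)` (`λ = 3^j`), a Bezout identity `Ba·A + Bb·(Q − A) = m ≠ 0`, integral
Hensel branches `Rz, Sz` of `D·z₁, D·z₂` along `O₊` to order `Q³` (`Rz ≡ D·λ·Y³`, `Sz ≡ Rz mod Q`), the Runge
function `(F₀, F₁, F₂, F₃)` of weights `(5, 3, 3, 1)` vanishing to order `Q³` along `O₊`, and `ν ≠ 0`. -/
structure DescentCert (Q A : ℤ[X]) where
  (j : ℕ) (T Ba Bb Rz Sz V W U₁ U₂ F0 F1 F2 F3 Om : ℤ[X]) (m D : ℤ)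
  eis : EisQ Q
  hA : A.natDegree ≤ 3
  hTdeg : T.natDegree ≤ 2
  hT : A + (((3 : ℤ) ^ j : ℤ) : ℤ[X]) ^ 2 * X ^ 6 = (((3 : ℤ) ^ j : ℤ) : ℤ[X]) ^ 2 * Q * T
  hbez : Ba * A + Bb * (Q - A) = (m : ℤ[X])
  hm : m ≠ 0
  hD : D ≠ 0
  hR : Rz ^ 2 + (D : ℤ[X]) ^ 2 * A = Q ^ 3 * U₁
  hS : Sz ^ 2 - (D : ℤ[X]) ^ 2 * (Q - A) = Q ^ 3 * U₂
  hRV : Rz = (D : ℤ[X]) * (((3 : ℤ) ^ j : ℤ) : ℤ[X]) * X ^ 3 + Q * V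
  hSW : Sz = Rz + Q * W
  hF0 : F0.natDegree ≤ 5
  hF1 : F1.natDegree ≤ 3
  hF2 : F2.natDegree ≤ 3
  hF3 : F3.natDegree ≤ 1
  hOm : (D : ℤ[X]) ^ 2 * F0 + (D : ℤ[X]) * F1 * Rz + (D : ℤ[X]) * F2 * Sz + F3 * Rz * Sz = Q ^ 3 * Om
  hnu : dsNu Q A F0 F1 F2 F3 ≠ 0

/-- the integer `I = D²·d⁵·Φ(r, z₁/d², z₂/d²) = D²·(F₀^h + F₁^h·z₁ + F₂^h·z₂ + F₃^h·z₁z₂)` (`F^h` = binary forms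
of degrees `5, 3, 3, 1` at `(num r, den r)`). -/
def dsI (F0 F1 F2 F3 : ℤ[X]) (D : ℤ) (r : ℚ) (z₁ z₂ : ℤ) : ℤ :=
  D ^ 2 * (hf F0 5 r + hf F1 3 r * z₁ + hf F2 3 r * z₂ + hf F3 1 r * (z₁ * z₂))

/-- `hf` read in `ℂ₂`: `F^h = den(r)ⁿ · F(r)`. -/
theorem hf_cast_Cp {F : ℤ[X]} {n : ℕ} (hF : F.natDegree ≤ n) (r : ℚ) :
    ((hf F n r : ℤ) : PadicAlgCl 2) = ((r.den : ℕ) : PadicAlgCl 2) ^ n * aeval (r : PadicAlgCl 2) F := by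
  rw [hf, hform_cast_Cp hF r]

/-- `hf` read in `ℝ`: `|F^h| = den(r)ⁿ · |F(r)|`. -/
theorem abs_hf_eq {F : ℤ[X]} {n : ℕ} (hF : F.natDegree ≤ n) (r : ℚ) :
    |((hf F n r : ℤ) : ℝ)| = (r.den : ℝ) ^ n * |aeval (r : ℝ) F| := abs_hform_eq hF r

/-- `hf` read in `ℝ` without absolute values. -/
theorem hf_cast_real {F : ℤ[X]} {n : ℕ} (hF : F.natDegree ≤ n) (r : ℚ) :
    ((hf F n r : ℤ) : ℝ) = (r.den : ℝ) ^ n * aeval (r : ℝ) F := by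
  have h1 := congrArg (Rat.cast : ℚ → ℝ) (hf_cast hF r)
  push_cast at h1
  rw [aeval_ratCast] at h1
  exact h1

/-- an archimedean ceiling: `|F(t)| ≤ M` on `|t| ≤ C`. -/
theorem exists_abs_aeval_le (F : ℤ[X]) (C : ℝ) : ∃ M : ℝ, 0 ≤ M ∧ ∀ t : ℝ, |t| ≤ C → |aeval t F| ≤ M := by
  have hfc : Continuous fun t : ℝ => |aeval t F| := (Polynomial.continuous_aeval (p := F)).abs
  have hne : (Set.Icc (-|C|) |C|).Nonempty := ⟨0, by simp [abs_nonneg]⟩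
  obtain ⟨t₀, -, hmax⟩ := isCompact_Icc.exists_isMaxOn hne hfc.continuousOn
  refine ⟨|aeval t₀ F|, abs_nonneg _, fun t ht => hmax ⟨?_, ?_⟩⟩
  · have := neg_abs_le t; have := le_abs_self C; linarith [abs_le.mp (ht.trans (le_abs_self C))]
  · exact (le_abs_self t).trans (ht.trans (le_abs_self C))

end Summit.Schanuel.Schanuel.Theorems.RootDecomp1KDescent

end
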